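import Literature.Probability.LatticeModels.SRWHeatKernelDifferences
import Literature.Probability.LatticeModels.TorusFourierProofs
import Mathlib.Analysis.Fourier.AddCircle
import Mathlib.Analysis.PSeries
import HarnessLib

/-!
# The heat kernel of the continuous-time simple random walk on the discrete circle `ℤ/Lℤ`

Topic `Probability/LatticeModels`, companion of `SRWHeatKernel1D.lean` /
`SRWHeatKernelDifferences.lean` (the heat kernel `srwHeatKernel t m = q_t(m)` of the rate-one
continuous-time simple random walk on `ℤ` and its Gaussian-weighted bounds) and of
`TorusFourierProofs.lean` (characters `ZMod.stdAddChar` of `ℤ/Lℤ`). We introduce the heat kernel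
of the same walk on the discrete circle `ℤ/Lℤ`,

* `torusHeatKernel t m = L⁻¹ ∑_{κ ∈ ℤ/Lℤ} e^{2πi κm/L} e^{-t(1 - cos(2πκ/L))}` (`m ∈ ℤ/Lℤ`; real, the
  sine parts cancelling under `κ ↦ -κ`; written with `ZMod.stdAddChar`),

and PROVE

* `hasSum_srwHeatKernel_fourier` — the Fourier expansion `e^{-t(1 - cos θ)} = ∑_{n ∈ ℤ} q_t(n) e^{inθ}`
  (the generating function `e^{t cos θ} = ∑ I_n(t) e^{inθ}` of the modified Bessel functions), from
  Mathlib's pointwise convergence of Fourier series with summable coefficients;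
* `torusHeatKernel_eq_tsum` — the **method of images**: `q^L_t(m) = ∑_{w ∈ ℤ} q_t(r + wL)` for every
  integer representative `r` of `m` (orthogonality of characters);
* `tsum_abs_periodize_le` — periodising a kernel with Gaussian weight `(1 + n²/T)^{-4}`, `T ≤ L²`,
  costs one power of the weight: `∑_w |f(r + wL)| ≤ B S (1 + r²/T)^{-3}` for `|r| ≤ L/2`;
* `abs_torusHeatKernel_le`, `abs_torusHeatKernel_fwdDiff_le`, `abs_torusHeatKernel_bwdDiff_le`,
  `abs_torusHeatKernel_sndDiff_le` — for `0 < t ≤ L²` and `m ∈ ℤ/Lℤ` with centred representative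
  `m̃ = valMinAbs m`: `|q^L_t(m)| ≤ K (1∨t)^{-1/2} (1 + m̃²/(1∨t))^{-3}`, first differences
  `≤ K (1∨t)^{-1} (…)^{-3}`, second differences `≤ K (1∨t)^{-3/2} (…)^{-3}`, with `K` independent of
  `L`, `t`, `m`.

These are the one-dimensional factors of the heat kernel of `(ℤ/Lℤ)^d` (a product over the
coordinates), used for the decay of the Hessian of the torus Green function
(`TorusGreenHessianDecay.lean`).

## References

* G. F. Lawler, V. Limic, *Random Walk: A Modern Introduction*, CUP 2010, §2.3 (heat kernel
  estimates) [LawlerLimic2010]; the method of images for the walk on the cycle is standard.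

## Mathlib

Used: `has_pointwise_sum_fourier_series_of_summable`, `fourierCoeff_eq_intervalIntegral`
(`Mathlib/Analysis/Fourier/AddCircle.lean`), `AddChar.sum_mulShift` with `ZMod.isPrimitive_stdAddChar`,
`Function.Injective.tsum_eq`, `ZMod.valMinAbs`. Mathlib has no heat kernel on `ZMod L`.
-/

noncomputable section

open MeasureTheory Set Filter Finset ZMod
open scoped Real Topology BigOperators ComplexConjugate

namespace Literature.Probability.LatticeModels

variable {L : ℕ} [NeZero L]

/-! ### Definition and realness -/

/-- The heat kernel at time `t` of the rate-one continuous-time simple random walk on the discrete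
circle `ℤ/Lℤ`, in Fourier form: `q^L_t(m) = L⁻¹ ∑_{κ ∈ ℤ/Lℤ} e^{2πiκm/L} e^{-t(1 - cos(2πκ/L))}`,
written with Mathlib's standard character `e(j) = e^{2πij/L}` of `ℤ/Lℤ` (`cos(2πκ/L) = Re e(κ)`) and
as the real part of the (real, `im = 0`) complex sum. [folklore] -/
def torusHeatKernel (t : ℝ) (m : ZMod L) : ℝ :=
  ((∑ κ : ZMod L, (stdAddChar (κ * m) : ℂ) *
      ((Real.exp (-(t * (1 - (stdAddChar κ : ℂ).re))) : ℝ) : ℂ)) / (L : ℂ)).re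

/-- `Re e(-κ) = Re e(κ)`. [folklore] -/
theorem re_stdAddChar_neg (κ : ZMod L) : (stdAddChar (-κ) : ℂ).re = (stdAddChar κ : ℂ).re := by
  rw [AddChar.map_neg_eq_conj, Complex.conj_re]

/-- The complex Fourier sum defining `torusHeatKernel` is invariant under conjugation (reindex
`κ ↦ -κ`). [folklore] -/
theorem conj_torusHeatSum (t : ℝ) (m : ZMod L) :
    conj (∑ κ : ZMod L, (stdAddChar (κ * m) : ℂ) *
        ((Real.exp (-(t * (1 - (stdAddChar κ : ℂ).re))) : ℝ) : ℂ)) =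
      ∑ κ : ZMod L, (stdAddChar (κ * m) : ℂ) *
        ((Real.exp (-(t * (1 - (stdAddChar κ : ℂ).re))) : ℝ) : ℂ) := by
  rw [map_sum]
  have hterm : ∀ κ : ZMod L, conj ((stdAddChar (κ * m) : ℂ) *
      ((Real.exp (-(t * (1 - (stdAddChar κ : ℂ).re))) : ℝ) : ℂ)) =
      (stdAddChar ((-κ) * m) : ℂ) *
        ((Real.exp (-(t * (1 - (stdAddChar (-κ) : ℂ).re))) : ℝ) : ℂ) := fun κ => by
    rw [map_mul, Complex.conj_ofReal, neg_mul, AddChar.map_neg_eq_conj, re_stdAddChar_neg]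
  simp_rw [hterm]
  exact Equiv.sum_comp (Equiv.neg (ZMod L)) (fun κ => (stdAddChar (κ * m) : ℂ) *
    ((Real.exp (-(t * (1 - (stdAddChar κ : ℂ).re))) : ℝ) : ℂ))

/-- **The torus heat kernel is the full complex Fourier sum** (its imaginary part vanishes):
`(q^L_t(m) : ℂ) = L⁻¹ ∑_κ e(κm) e^{-t(1 - Re e(κ))}`. [folklore] -/
theorem ofReal_torusHeatKernel (t : ℝ) (m : ZMod L) :
    (torusHeatKernel t m : ℂ) = (∑ κ : ZMod L, (stdAddChar (κ * m) : ℂ) *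
      ((Real.exp (-(t * (1 - (stdAddChar κ : ℂ).re))) : ℝ) : ℂ)) / (L : ℂ) := by
  unfold torusHeatKernel
  refine Complex.conj_eq_iff_re.1 ?_
  rw [map_div₀, Complex.conj_natCast, conj_torusHeatSum]

/-- `q^L_t` is continuous in `t`. [folklore] -/
theorem continuous_torusHeatKernel (m : ZMod L) : Continuous fun t : ℝ => torusHeatKernel t m := by
  unfold torusHeatKernel
  fun_prop

/-! ### The Fourier expansion of the heat weight -/

/-- The heat kernel `n ↦ q_t(n)` is absolutely summable over `ℤ` for `t > 0` (it is
`O((1 ∨ t)/n²)` by `srwHeatKernel_decay`). [folklore] -/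
theorem summable_srwHeatKernel {t : ℝ} (ht : 0 < t) : Summable fun n : ℤ => srwHeatKernel t n := by
  obtain ⟨A, hA, hq⟩ := srwHeatKernel_decay 1
  set T : ℝ := max 1 t with hT
  have hT1 : 1 ≤ T := le_max_left _ _
  have hT0 : 0 < T := by positivity
  refine Summable.of_norm_bounded_eventually
    (((Real.summable_one_div_int_pow.2 one_lt_two).mul_left (A * T))) ?_
  rw [Filter.eventually_cofinite]
  refine (Set.finite_singleton (0 : ℤ)).subset fun n hn => ?_
  by_contra h0
  apply hn
  have h1 := hq t ht n
  have hn2 : (0 : ℝ) < (n : ℝ) ^ 2 := by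
    have : (n : ℝ) ≠ 0 := by exact_mod_cast h0
    positivity
  rw [Real.norm_eq_abs]
  calc |srwHeatKernel t n| ≤ A * T ^ (-(1 / 2 : ℝ)) * ((1 + (n : ℝ) ^ 2 / T) ^ 1)⁻¹ := h1
    _ ≤ A * 1 * ((n : ℝ) ^ 2 / T)⁻¹ := by
        gcongr
        · exact Real.rpow_le_one_of_one_le_of_nonpos hT1 (by norm_num)
        · rw [pow_one]; linarith
    _ = A * T * (1 / (n : ℝ) ^ 2) := by field_simp

/-- **The Fourier expansion of the heat weight** (generating function of the modified Bessel
functions, `e^{t cos θ} = ∑_n I_n(t) e^{inθ}`, times `e^{-t}`): for `t > 0` and every real `θ`,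
`∑_{n ∈ ℤ} q_t(n) e^{inθ} = e^{-t(1 - cos θ)}`. Proof: `q_t(n)` is the `n`-th Fourier coefficient
of the continuous function `θ ↦ e^{-t(1 - cos θ)}` on `ℝ/2πℤ`, and the coefficients are summable,
so Mathlib's `has_pointwise_sum_fourier_series_of_summable` applies. [folklore] -/
theorem hasSum_srwHeatKernel_fourier {t : ℝ} (ht : 0 < t) (θ : ℝ) :
    HasSum (fun n : ℤ => (srwHeatKernel t n : ℂ) * Complex.exp (Complex.I * n * θ))
      ((Real.exp (-(t * (1 - Real.cos θ))) : ℝ) : ℂ) := by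
  haveI : Fact (0 < 2 * π) := ⟨by positivity⟩
  set g : ℝ → ℂ := fun θ => ((Real.exp (-(t * (1 - Real.cos θ))) : ℝ) : ℂ) with hg
  have hper : Function.Periodic g (2 * π) := fun θ => by
    simp only [hg]
    rw [Real.cos_add_two_pi]
  have hgc : Continuous g := by simp only [hg]; fun_prop
  let F : C(AddCircle (2 * π), ℂ) := ⟨hper.lift, hgc.quotient_liftOn' _⟩
  have hF : ∀ x : ℝ, F (x : AddCircle (2 * π)) = g x := fun x => rfl
  have h2π : (2 * π : ℝ) ≠ 0 := by positivity
  -- the Fourier coefficients of `F` are the `q_t(n)`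
  have hcoeff : ∀ n : ℤ, fourierCoeff F n = (srwHeatKernel t n : ℂ) := by
    intro n
    rw [fourierCoeff_eq_intervalIntegral F n (-π), show -π + 2 * π = π by ring]
    have hint : ∀ x : ℝ, (fourier (-n)) (x : AddCircle (2 * π)) • F (x : AddCircle (2 * π)) =
        srwHeatIntegrand t (-n) x := by
      intro x
      rw [fourier_coe_apply, hF, smul_eq_mul, hg]
      unfold srwHeatIntegrand
      simp only [Complex.ofReal_exp]
      push_cast
      congr 1
      · congr 1
        field_simp
      · congr 1
        ring
    simp_rw [hint]
    rw [integral_srwHeatIntegrand, srwHeatKernel_neg, Complex.real_smul]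
    push_cast
    field_simp
  have hsum : Summable (fourierCoeff F) := by
    have : fourierCoeff F = fun n => (srwHeatKernel t n : ℂ) := funext hcoeff
    rw [this]
    exact Complex.summable_ofReal.2 (summable_srwHeatKernel ht)
  have h := has_pointwise_sum_fourier_series_of_summable hsum (θ : AddCircle (2 * π))
  rw [hF] at h
  convert h using 1
  funext n
  rw [hcoeff, fourier_coe_apply, smul_eq_mul]
  congr 1
  congr 1
  push_cast
  field_simp

/-! ### The method of images -/

/-- A standard character value in exponential form: `e(κ · r) = exp(i r · 2πκ/L)` for `r ∈ ℤ`
(representative `κ.val`). [folklore] -/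
theorem stdAddChar_mul_intCast (κ : ZMod L) (r : ℤ) :
    (stdAddChar (κ * (r : ZMod L)) : ℂ) =
      Complex.exp (Complex.I * r * (2 * π * (κ.val : ℝ) / L : ℝ)) := by
  have : κ * (r : ZMod L) = (((κ.val : ℤ) * r : ℤ) : ZMod L) := by
    push_cast
    rw [ZMod.natCast_zmod_val]
  rw [this, ZMod.stdAddChar_coe]
  congr 1
  push_cast
  ring

/-- `Re e(κ) = cos(2πκ/L)`. [folklore] -/
theorem re_stdAddChar (κ : ZMod L) :
    (stdAddChar κ : ℂ).re = Real.cos (2 * π * (κ.val : ℝ) / L) := by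
  have h := stdAddChar_mul_intCast κ 1
  rw [Int.cast_one, mul_one] at h
  rw [h, show Complex.I * ((1 : ℤ) : ℂ) * ((2 * π * (κ.val : ℝ) / L : ℝ) : ℂ) =
    ((2 * π * (κ.val : ℝ) / L : ℝ) : ℂ) * Complex.I by push_cast; ring, Complex.exp_ofReal_mul_I_re]

/-- **Orthogonality**: `∑_κ e(κ x) = L · 1[x = 0]` on `ℤ/Lℤ` (Mathlib `AddChar.sum_mulShift`). [folklore] -/
theorem sum_stdAddChar_mul (x : ZMod L) :
    ∑ κ : ZMod L, (stdAddChar (κ * x) : ℂ) = if x = 0 then (L : ℂ) else 0 := by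
  classical
  rw [AddChar.sum_mulShift x (isPrimitive_stdAddChar L), ZMod.card]
  split_ifs <;> simp

/-- **The method of images** for the heat kernel on the discrete circle: for `t > 0` and every
integer `r`, `q^L_t(r mod L) = ∑_{w ∈ ℤ} q_t(r + wL)`, the series converging absolutely. Proof:
insert the Fourier expansion `e^{-t(1 - cos(2πκ/L))} = ∑_n q_t(n) e^{2πi nκ/L}` into the finite
Fourier sum and use the orthogonality of characters, `L⁻¹ ∑_κ e^{2πiκ(r + n)/L} = 1[L ∣ r + n]`.
[folklore] -/
theorem torusHeatKernel_eq_tsum {t : ℝ} (ht : 0 < t) (r : ℤ) :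
    Summable (fun w : ℤ => srwHeatKernel t (r + w * L)) ∧
      torusHeatKernel t ((r : ℤ) : ZMod L) = ∑' w : ℤ, srwHeatKernel t (r + w * L) := by
  have hL0' : L ≠ 0 := NeZero.ne L
  have hL0 : (L : ℤ) ≠ 0 := by exact_mod_cast hL0'
  have hLC : (L : ℂ) ≠ 0 := by exact_mod_cast hL0'
  have hsq := summable_srwHeatKernel ht
  have hinj : Function.Injective fun w : ℤ => r + w * L := fun a b hab => by
    simpa [hL0'] using hab
  have hsw : Summable (fun w : ℤ => srwHeatKernel t (r + w * L)) := hsq.comp_injective hinj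
  refine ⟨hsw, ?_⟩
  -- work in `ℂ`
  have hC : (torusHeatKernel t ((r : ℤ) : ZMod L) : ℂ) =
      ((∑' w : ℤ, srwHeatKernel t (r + w * L) : ℝ) : ℂ) := by
    rw [Complex.ofReal_tsum, ofReal_torusHeatKernel]
    -- each weight as a Fourier series
    set θ : ZMod L → ℝ := fun κ => 2 * π * (κ.val : ℝ) / L with hθ
    have hW : ∀ κ : ZMod L, ((Real.exp (-(t * (1 - (stdAddChar κ : ℂ).re))) : ℝ) : ℂ) =
        ∑' n : ℤ, (srwHeatKernel t n : ℂ) * Complex.exp (Complex.I * n * θ κ) := fun κ => by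
      rw [re_stdAddChar, (hasSum_srwHeatKernel_fourier ht (θ κ)).tsum_eq]
    have hsn : ∀ κ : ZMod L, Summable fun n : ℤ =>
        (srwHeatKernel t n : ℂ) * Complex.exp (Complex.I * n * θ κ) := fun κ =>
      (hasSum_srwHeatKernel_fourier ht (θ κ)).summable
    -- the summand after multiplying by the character `e(κ r)`
    set Φ : ZMod L → ℤ → ℂ := fun κ n =>
      (srwHeatKernel t n : ℂ) * (stdAddChar (κ * ((n + r : ℤ) : ZMod L)) : ℂ) with hΦ
    have hΦs : ∀ κ : ZMod L, Summable (Φ κ) := fun κ => by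
      refine Summable.of_norm_bounded (g := fun n : ℤ => ‖(srwHeatKernel t n : ℂ)‖)
        (Complex.summable_ofReal.2 hsq).norm fun n => ?_
      rw [hΦ, norm_mul, AddChar.norm_apply, mul_one]
    have hterm : ∀ κ : ZMod L, (stdAddChar (κ * ((r : ℤ) : ZMod L)) : ℂ) *
        ((Real.exp (-(t * (1 - (stdAddChar κ : ℂ).re))) : ℝ) : ℂ) = ∑' n : ℤ, Φ κ n := fun κ => by
      rw [hW κ, ← tsum_mul_left]
      refine tsum_congr fun n => ?_
      simp only [hΦ, hθ]
      rw [stdAddChar_mul_intCast, stdAddChar_mul_intCast,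
        show Complex.I * ((n + r : ℤ) : ℂ) * ((2 * π * (κ.val : ℝ) / L : ℝ) : ℂ) =
          Complex.I * (r : ℂ) * ((2 * π * (κ.val : ℝ) / L : ℝ) : ℂ) +
            Complex.I * (n : ℂ) * ((2 * π * (κ.val : ℝ) / L : ℝ) : ℂ) by push_cast; ring,
        Complex.exp_add]
      ring
    simp_rw [hterm]
    rw [← Summable.tsum_finsetSum (fun κ _ => hΦs κ), div_eq_inv_mul, ← tsum_mul_left]
    -- orthogonality
    have horth : ∀ n : ℤ, (L : ℂ)⁻¹ * ∑ κ : ZMod L, Φ κ n =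
        if (L : ℤ) ∣ n + r then (srwHeatKernel t n : ℂ) else 0 := fun n => by
      simp only [hΦ]
      rw [← Finset.mul_sum, sum_stdAddChar_mul]
      by_cases hd : (L : ℤ) ∣ n + r
      · rw [if_pos ((ZMod.intCast_zmod_eq_zero_iff_dvd _ _).2 hd), if_pos hd]
        field_simp
      · rw [if_neg (mt (ZMod.intCast_zmod_eq_zero_iff_dvd _ _).1 hd), if_neg hd]
        simp
    simp_rw [horth]
    -- reindex the support `{n : L ∣ n + r} = {wL - r}`
    have hg : Function.Injective fun w : ℤ => w * L - r := fun a b hab => by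
      simpa [hL0'] using hab
    have hsupp : (Function.support fun n : ℤ =>
        if (L : ℤ) ∣ n + r then (srwHeatKernel t n : ℂ) else 0) ⊆
        Set.range fun w : ℤ => w * L - r := by
      intro n hn
      rw [Function.mem_support] at hn
      have hdvd : (L : ℤ) ∣ n + r := by
        by_contra h
        exact hn (if_neg h)
      obtain ⟨w, hw⟩ := hdvd
      exact ⟨w, by show w * (L : ℤ) - r = n; linarith⟩
    rw [← hg.tsum_eq hsupp]
    simp only [sub_add_cancel, dvd_mul_left, if_true]
    -- `q_t(wL - r) = q_t(r - wL)` and `w ↦ -w`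
    rw [← tsum_comp_neg]
    refine tsum_congr fun w => ?_
    rw [← srwHeatKernel_neg]
    congr 2
    ring
  exact_mod_cast hC

/-! ### Periodised Gaussian weights -/

/-- `∑_{w ∈ ℤ} (1 + w²/4)⁻¹ < ∞`. [folklore] -/
theorem summable_inv_one_add_sq_div_four : Summable fun w : ℤ => (1 + (w : ℝ) ^ 2 / 4)⁻¹ := by
  refine Summable.of_norm_bounded_eventually
    ((Real.summable_one_div_int_pow.2 one_lt_two).mul_left 4) ?_
  rw [Filter.eventually_cofinite]
  refine (Set.finite_singleton (0 : ℤ)).subset fun w hw => ?_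
  by_contra h0
  apply hw
  have hw2 : (0 : ℝ) < (w : ℝ) ^ 2 := by
    have : (w : ℝ) ≠ 0 := by exact_mod_cast h0
    positivity
  rw [Real.norm_eq_abs, abs_of_pos (by positivity)]
  calc (1 + (w : ℝ) ^ 2 / 4)⁻¹ ≤ ((w : ℝ) ^ 2 / 4)⁻¹ := by
        gcongr; linarith
    _ = 4 * (1 / (w : ℝ) ^ 2) := by field_simp

/-- `1 ≤ ∑_{w ∈ ℤ} (1 + w²/4)⁻¹` (the `w = 0` term). [folklore] -/
theorem one_le_tsum_inv_one_add_sq_div_four : (1 : ℝ) ≤ ∑' w : ℤ, (1 + (w : ℝ) ^ 2 / 4)⁻¹ := by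
  have h := summable_inv_one_add_sq_div_four.le_tsum 0 (fun j _ => by positivity)
  simpa using h

omit [NeZero L] in
/-- **Periodising a Gaussian weight costs one power**: if `|f(n)| ≤ B (1 + n²/T)^{-4}` on `ℤ` with
`1 ≤ T ≤ L²`, then for every `r` with `2|r| ≤ L` the images `n = r + wL` satisfy
`∑_w |f(r + wL)| ≤ B S (1 + r²/T)^{-3}`, `S = ∑_w (1 + w²/4)⁻¹` (for `w ≠ 0`, `|r + wL| ≥ |w|L/2`,
whence `(r + wL)² ≥ r²` and `(r + wL)²/T ≥ w²/4`). [folklore] -/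
theorem tsum_abs_periodize_le {f : ℤ → ℝ} {B T : ℝ} (hB : 0 ≤ B) (hT1 : 1 ≤ T)
    (hTL : T ≤ (L : ℝ) ^ 2) (hf : ∀ n : ℤ, |f n| ≤ B * ((1 + (n : ℝ) ^ 2 / T) ^ 4)⁻¹) {r : ℤ}
    (hr : 2 * |r| ≤ L) :
    Summable (fun w : ℤ => f (r + w * L)) ∧
      ∑' w : ℤ, |f (r + w * L)| ≤
        B * (∑' w : ℤ, (1 + (w : ℝ) ^ 2 / 4)⁻¹) * ((1 + (r : ℝ) ^ 2 / T) ^ 3)⁻¹ := by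
  have hT0 : 0 < T := by positivity
  have hLr : 2 * |(r : ℝ)| ≤ L := by exact_mod_cast hr
  -- the pointwise comparison of weights
  have key : ∀ w : ℤ, ((1 + ((r + w * L : ℤ) : ℝ) ^ 2 / T) ^ 4)⁻¹ ≤
      ((1 + (r : ℝ) ^ 2 / T) ^ 3)⁻¹ * (1 + (w : ℝ) ^ 2 / 4)⁻¹ := by
    intro w
    have hx0 : 0 ≤ (r : ℝ) ^ 2 / T := by positivity
    rcases eq_or_ne w 0 with rfl | hw
    · simp only [Int.cast_zero, zero_mul, add_zero]
      rw [show (0 : ℝ) ^ 2 / 4 = 0 by norm_num, add_zero, inv_one, mul_one]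
      rw [inv_le_inv₀ (by positivity) (by positivity)]
      calc (1 + (r : ℝ) ^ 2 / T) ^ 3 = (1 + (r : ℝ) ^ 2 / T) ^ 3 * 1 := (mul_one _).symm
        _ ≤ (1 + (r : ℝ) ^ 2 / T) ^ 3 * (1 + (r : ℝ) ^ 2 / T) := by gcongr; linarith
        _ = (1 + (r : ℝ) ^ 2 / T) ^ 4 := by ring
    · have hw1 : (1 : ℝ) ≤ |(w : ℝ)| := by
        rw [← Int.cast_abs]; exact_mod_cast Int.one_le_abs hw
      set n : ℝ := ((r + w * L : ℤ) : ℝ) with hn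
      have hn' : n = r + w * L := by rw [hn]; push_cast; ring
      -- `|n| ≥ |w| L / 2`
      have hnabs : |(w : ℝ)| * L / 2 ≤ |n| := by
        have h1 : |(w : ℝ)| * L - |(r : ℝ)| ≤ |n| := by
          rw [hn']
          have := abs_sub_abs_le_abs_sub ((w : ℝ) * L) (-(r : ℝ))
          rw [abs_neg, abs_mul, Nat.abs_cast, sub_neg_eq_add, add_comm] at this
          exact this
        have hL0 : (0 : ℝ) ≤ L := Nat.cast_nonneg L
        nlinarith
      have hn2 : (w : ℝ) ^ 2 * (L : ℝ) ^ 2 / 4 ≤ n ^ 2 := by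
        have h0 : 0 ≤ |(w : ℝ)| * L / 2 := by positivity
        have := mul_le_mul hnabs hnabs h0 (abs_nonneg _)
        rw [← sq, ← sq, sq_abs] at this
        calc (w : ℝ) ^ 2 * (L : ℝ) ^ 2 / 4 = (|(w : ℝ)| * L / 2) ^ 2 := by rw [div_pow, mul_pow, sq_abs]; ring
          _ ≤ n ^ 2 := this
      -- `n² ≥ r²` and `n²/T ≥ w²/4`
      have hr2 : (r : ℝ) ^ 2 ≤ n ^ 2 := by
        have h1 : (r : ℝ) ^ 2 ≤ (L : ℝ) ^ 2 / 4 := by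
          have : |(r : ℝ)| ^ 2 ≤ ((L : ℝ) / 2) ^ 2 := by
            apply pow_le_pow_left₀ (abs_nonneg _); linarith
          rw [sq_abs] at this; linarith
        have h2 : (L : ℝ) ^ 2 / 4 ≤ (w : ℝ) ^ 2 * (L : ℝ) ^ 2 / 4 := by
          have : (1 : ℝ) ≤ (w : ℝ) ^ 2 := by rw [← sq_abs]; nlinarith
          nlinarith [sq_nonneg (L : ℝ)]
        linarith
      have hw2 : (w : ℝ) ^ 2 / 4 ≤ n ^ 2 / T := by
        rw [div_le_div_iff₀ (by norm_num) hT0]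
        nlinarith [sq_nonneg (w : ℝ)]
      rw [← mul_inv, inv_le_inv₀ (by positivity) (by positivity)]
      calc (1 + (r : ℝ) ^ 2 / T) ^ 3 * (1 + (w : ℝ) ^ 2 / 4)
          ≤ (1 + n ^ 2 / T) ^ 3 * (1 + n ^ 2 / T) := by gcongr
        _ = (1 + n ^ 2 / T) ^ 4 := by ring
  -- the dominating summable sequence
  set g : ℤ → ℝ := fun w => B * ((1 + (r : ℝ) ^ 2 / T) ^ 3)⁻¹ * (1 + (w : ℝ) ^ 2 / 4)⁻¹ with hg
  have hgs : Summable g := summable_inv_one_add_sq_div_four.mul_left _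
  have hfg : ∀ w : ℤ, ‖f (r + w * L)‖ ≤ g w := fun w => by
    rw [Real.norm_eq_abs, hg]
    calc |f (r + w * L)| ≤ B * ((1 + ((r + w * L : ℤ) : ℝ) ^ 2 / T) ^ 4)⁻¹ := hf _
      _ ≤ B * (((1 + (r : ℝ) ^ 2 / T) ^ 3)⁻¹ * (1 + (w : ℝ) ^ 2 / 4)⁻¹) :=
          mul_le_mul_of_nonneg_left (key w) hB
      _ = _ := by ring
  have hs : Summable (fun w : ℤ => f (r + w * L)) := Summable.of_norm_bounded hgs hfg
  refine ⟨hs, ?_⟩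
  calc ∑' w : ℤ, |f (r + w * L)| ≤ ∑' w : ℤ, g w :=
        Summable.tsum_le_tsum (fun w => (Real.norm_eq_abs _).symm.le.trans (hfg w)) hs.abs hgs
    _ = B * (∑' w : ℤ, (1 + (w : ℝ) ^ 2 / 4)⁻¹) * ((1 + (r : ℝ) ^ 2 / T) ^ 3)⁻¹ := by
        rw [hg, tsum_mul_left]; ring

/-! ### Bounds on the torus heat kernel and its differences for `t ≤ L²` -/

/-- The centred representative satisfies `2|m̃| ≤ L`. [folklore] -/
theorem two_mul_abs_valMinAbs_le (m : ZMod L) : 2 * |m.valMinAbs| ≤ (L : ℤ) := by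
  have h := m.valMinAbs_mem_Ioc
  rw [show (2 : ℤ) * |m.valMinAbs| = |m.valMinAbs * 2| by rw [abs_mul, abs_two, mul_comm]]
  exact abs_le.2 ⟨by linarith [h.1], h.2⟩

/-- **From `ℤ` to `ℤ/Lℤ`**: a kernel `f` on `ℤ` with `|f(n)| ≤ B (1 + n²/(1∨t))^{-4}` has, for
`0 < t ≤ L²`, absolutely convergent image sums over the classes `m̃ + Lℤ` (`m̃ = valMinAbs m`) bounded
by `B S (1 + m̃²/(1∨t))^{-3}`, `S = ∑_w (1 + w²/4)⁻¹`. [folklore] -/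
theorem abs_tsum_periodize_le {f : ℤ → ℝ} {B t : ℝ} (hB : 0 ≤ B)
    (htL : t ≤ (L : ℝ) ^ 2) (hf : ∀ n : ℤ, |f n| ≤ B * ((1 + (n : ℝ) ^ 2 / max 1 t) ^ 4)⁻¹)
    (m : ZMod L) :
    Summable (fun w : ℤ => f (m.valMinAbs + w * L)) ∧
      |∑' w : ℤ, f (m.valMinAbs + w * L)| ≤
        B * (∑' w : ℤ, (1 + (w : ℝ) ^ 2 / 4)⁻¹) *
          ((1 + (m.valMinAbs : ℝ) ^ 2 / max 1 t) ^ 3)⁻¹ := by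
  have hT1 : 1 ≤ max 1 t := le_max_left _ _
  have hL1 : (1 : ℝ) ≤ L := by exact_mod_cast Nat.one_le_iff_ne_zero.2 (NeZero.ne L)
  have hTL : max 1 t ≤ (L : ℝ) ^ 2 := max_le (by nlinarith) htL
  obtain ⟨hs, hle⟩ := tsum_abs_periodize_le hB hT1 hTL hf (two_mul_abs_valMinAbs_le m)
  refine ⟨hs, ?_⟩
  calc |∑' w : ℤ, f (m.valMinAbs + w * L)| ≤ ∑' w : ℤ, |f (m.valMinAbs + w * L)| := by
        have h := norm_tsum_le_tsum_norm hs.norm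
        simpa only [Real.norm_eq_abs] using h
    _ ≤ _ := hle

/-- **Size of the torus heat kernel**: there is `K > 0` such that for all `L ≥ 1`, `0 < t ≤ L²` and
`m ∈ ℤ/Lℤ`, `|q^L_t(m)| ≤ K (1∨t)^{-1/2} (1 + m̃²/(1∨t))^{-3}` (`m̃ = valMinAbs m`): the method of
images and the Gaussian-weighted bound `srwHeatKernel_decay` on `ℤ`. [folklore] -/
theorem abs_torusHeatKernel_le : ∃ K : ℝ, 0 < K ∧ ∀ (L : ℕ) [NeZero L] (t : ℝ), 0 < t →
    t ≤ (L : ℝ) ^ 2 → ∀ m : ZMod L, |torusHeatKernel t m| ≤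
      K * (max 1 t) ^ (-(1 / 2 : ℝ)) * ((1 + (m.valMinAbs : ℝ) ^ 2 / max 1 t) ^ 3)⁻¹ := by
  obtain ⟨A, hA, hq⟩ := srwHeatKernel_decay 4
  have hS := one_le_tsum_inv_one_add_sq_div_four
  refine ⟨A * ∑' w : ℤ, (1 + (w : ℝ) ^ 2 / 4)⁻¹, by positivity, ?_⟩
  intro L _ t ht htL m
  obtain ⟨-, hrep⟩ := torusHeatKernel_eq_tsum (L := L) ht m.valMinAbs
  rw [ZMod.coe_valMinAbs] at hrep
  rw [hrep]
  have h := (abs_tsum_periodize_le (f := fun n => srwHeatKernel t n)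
    (B := A * (max 1 t) ^ (-(1 / 2 : ℝ))) (by positivity) htL (fun n => hq t ht n) m).2
  calc _ ≤ _ := h
    _ = _ := by ring

/-- **Forward difference of the torus heat kernel**: there is `K > 0` such that for all `L ≥ 1`,
`0 < t ≤ L²` and `m ∈ ℤ/Lℤ`, `|q^L_t(m+1) - q^L_t(m)| ≤ K (1∨t)^{-1} (1 + m̃²/(1∨t))^{-3}`.
[folklore] -/
theorem abs_torusHeatKernel_fwdDiff_le : ∃ K : ℝ, 0 < K ∧ ∀ (L : ℕ) [NeZero L] (t : ℝ), 0 < t →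
    t ≤ (L : ℝ) ^ 2 → ∀ m : ZMod L, |torusHeatKernel t (m + 1) - torusHeatKernel t m| ≤
      K * (max 1 t)⁻¹ * ((1 + (m.valMinAbs : ℝ) ^ 2 / max 1 t) ^ 3)⁻¹ := by
  obtain ⟨A, hA, hq⟩ := srwHeatKernel_fwdDiff_decay 4
  have hS := one_le_tsum_inv_one_add_sq_div_four
  refine ⟨A * ∑' w : ℤ, (1 + (w : ℝ) ^ 2 / 4)⁻¹, by positivity, ?_⟩
  intro L _ t ht htL m
  obtain ⟨hs0, hrep0⟩ := torusHeatKernel_eq_tsum (L := L) ht m.valMinAbs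
  obtain ⟨hs1, hrep1⟩ := torusHeatKernel_eq_tsum (L := L) ht (m.valMinAbs + 1)
  rw [ZMod.coe_valMinAbs] at hrep0
  rw [Int.cast_add, Int.cast_one, ZMod.coe_valMinAbs] at hrep1
  rw [hrep0, hrep1, ← hs1.tsum_sub hs0]
  have e : ∀ w : ℤ, srwHeatKernel t (m.valMinAbs + 1 + w * L) - srwHeatKernel t (m.valMinAbs + w * L) =
      srwHeatKernel t (m.valMinAbs + w * L + 1) - srwHeatKernel t (m.valMinAbs + w * L) := fun w => by
    rw [show m.valMinAbs + 1 + w * L = m.valMinAbs + w * L + 1 by ring]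
  simp_rw [e]
  have h := (abs_tsum_periodize_le (f := fun n => srwHeatKernel t (n + 1) - srwHeatKernel t n)
    (B := A * (max 1 t)⁻¹) (by positivity) htL (fun n => hq t ht n) m).2
  calc _ ≤ _ := h
    _ = _ := by ring

/-- **Backward difference of the torus heat kernel**: there is `K > 0` such that for all `L ≥ 1`,
`0 < t ≤ L²` and `m ∈ ℤ/Lℤ`, `|q^L_t(m) - q^L_t(m-1)| ≤ K (1∨t)^{-1} (1 + m̃²/(1∨t))^{-3}`.
[folklore] -/
theorem abs_torusHeatKernel_bwdDiff_le : ∃ K : ℝ, 0 < K ∧ ∀ (L : ℕ) [NeZero L] (t : ℝ), 0 < t →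
    t ≤ (L : ℝ) ^ 2 → ∀ m : ZMod L, |torusHeatKernel t m - torusHeatKernel t (m - 1)| ≤
      K * (max 1 t)⁻¹ * ((1 + (m.valMinAbs : ℝ) ^ 2 / max 1 t) ^ 3)⁻¹ := by
  obtain ⟨A, hA, hq⟩ := srwHeatKernel_bwdDiff_decay 4
  have hS := one_le_tsum_inv_one_add_sq_div_four
  refine ⟨A * ∑' w : ℤ, (1 + (w : ℝ) ^ 2 / 4)⁻¹, by positivity, ?_⟩
  intro L _ t ht htL m
  obtain ⟨hs0, hrep0⟩ := torusHeatKernel_eq_tsum (L := L) ht m.valMinAbs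
  obtain ⟨hs1, hrep1⟩ := torusHeatKernel_eq_tsum (L := L) ht (m.valMinAbs - 1)
  rw [ZMod.coe_valMinAbs] at hrep0
  rw [Int.cast_sub, Int.cast_one, ZMod.coe_valMinAbs] at hrep1
  rw [hrep0, hrep1, ← hs0.tsum_sub hs1]
  have e : ∀ w : ℤ, srwHeatKernel t (m.valMinAbs + w * L) - srwHeatKernel t (m.valMinAbs - 1 + w * L) =
      srwHeatKernel t (m.valMinAbs + w * L) - srwHeatKernel t (m.valMinAbs + w * L - 1) := fun w => by
    rw [show m.valMinAbs - 1 + w * L = m.valMinAbs + w * L - 1 by ring]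
  simp_rw [e]
  have h := (abs_tsum_periodize_le (f := fun n => srwHeatKernel t n - srwHeatKernel t (n - 1))
    (B := A * (max 1 t)⁻¹) (by positivity) htL (fun n => hq t ht n) m).2
  calc _ ≤ _ := h
    _ = _ := by ring

/-- **Second difference of the torus heat kernel**: there is `K > 0` such that for all `L ≥ 1`,
`0 < t ≤ L²` and `m ∈ ℤ/Lℤ`,
`|q^L_t(m+1) - 2q^L_t(m) + q^L_t(m-1)| ≤ K (1∨t)^{-1}(1∨t)^{-1/2} (1 + m̃²/(1∨t))^{-3}`. [folklore] -/
theorem abs_torusHeatKernel_sndDiff_le : ∃ K : ℝ, 0 < K ∧ ∀ (L : ℕ) [NeZero L] (t : ℝ), 0 < t →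
    t ≤ (L : ℝ) ^ 2 → ∀ m : ZMod L,
      |torusHeatKernel t (m + 1) - 2 * torusHeatKernel t m + torusHeatKernel t (m - 1)| ≤
      K * ((max 1 t)⁻¹ * (max 1 t) ^ (-(1 / 2 : ℝ))) *
        ((1 + (m.valMinAbs : ℝ) ^ 2 / max 1 t) ^ 3)⁻¹ := by
  obtain ⟨A, hA, hq⟩ := srwHeatKernel_sndDiff_decay 4
  have hS := one_le_tsum_inv_one_add_sq_div_four
  refine ⟨A * ∑' w : ℤ, (1 + (w : ℝ) ^ 2 / 4)⁻¹, by positivity, ?_⟩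
  intro L _ t ht htL m
  obtain ⟨hs0, hrep0⟩ := torusHeatKernel_eq_tsum (L := L) ht m.valMinAbs
  obtain ⟨hs1, hrep1⟩ := torusHeatKernel_eq_tsum (L := L) ht (m.valMinAbs + 1)
  obtain ⟨hs2, hrep2⟩ := torusHeatKernel_eq_tsum (L := L) ht (m.valMinAbs - 1)
  rw [ZMod.coe_valMinAbs] at hrep0
  rw [Int.cast_add, Int.cast_one, ZMod.coe_valMinAbs] at hrep1
  rw [Int.cast_sub, Int.cast_one, ZMod.coe_valMinAbs] at hrep2
  rw [hrep0, hrep1, hrep2, ← tsum_mul_left, ← hs1.tsum_sub (hs0.mul_left 2),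
    ← (hs1.sub (hs0.mul_left 2)).tsum_add hs2]
  have e : ∀ w : ℤ, srwHeatKernel t (m.valMinAbs + 1 + w * L) - 2 * srwHeatKernel t (m.valMinAbs + w * L) +
      srwHeatKernel t (m.valMinAbs - 1 + w * L) =
      srwHeatKernel t (m.valMinAbs + w * L + 1) - 2 * srwHeatKernel t (m.valMinAbs + w * L) +
        srwHeatKernel t (m.valMinAbs + w * L - 1) := fun w => by
    rw [show m.valMinAbs - 1 + w * L = m.valMinAbs + w * L - 1 by ring,
      show m.valMinAbs + 1 + w * L = m.valMinAbs + w * L + 1 by ring]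
  simp_rw [e]
  have h := (abs_tsum_periodize_le
    (f := fun n => srwHeatKernel t (n + 1) - 2 * srwHeatKernel t n + srwHeatKernel t (n - 1))
    (B := A * ((max 1 t)⁻¹ * (max 1 t) ^ (-(1 / 2 : ℝ)))) (by positivity) htL
    (fun n => hq t ht n) m).2
  calc _ ≤ _ := h
    _ = _ := by ring

end Literature.Probability.LatticeModels
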